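import Summits.KontsevichZagierPeriods.KontsevichZagierPeriods.Theorems.OctahedralSymmetryOctahedralSpanAllWeightsDefs
import Summits.KontsevichZagierPeriods.KontsevichZagierPeriods.Theorems.OctahedralSymmetryOctahedralSpanAllWeightsStubWeightTwo
import Summits.KontsevichZagierPeriods.KontsevichZagierPeriods.Theorems.OctahedralSymmetryOctahedralSpanAllWeightsStubWeightThree
import Summits.KontsevichZagierPeriods.KontsevichZagierPeriods.Theorems.OctahedralSymmetryOctahedralSpanAllWeightsStubWeightFour
import Summits.KontsevichZagierPeriods.KontsevichZagierPeriods.Theorems.OctahedralSymmetryOctahedralSpanAllWeightsRealForm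

/-!
# Crux `OctahedralSpanAllWeights` (stmt-KontsevichZagierPeriods-9659), line `Sketch`: the low weights

The typed crux `OctaSpan.OctahedralSpanAllWeights = ∀ w, SpanBound w` ("the regularisation-free
families reach corank `≤ 2^w`") in the weights where it is now MACHINE-CHECKED rather than computed
modulo a prime:

* `twoLetterNormalForm_zero`, `twoLetterNormalForm_one` — weights `0` and `1` (the empty word; the
  three letters `i, −1, −i`, the seed `[−1] − [i] − [−i] = dilGen [2]`);
* `spanBound_of_le_three` — `SpanBound w` for every `w ≤ 3` (coranks `≤ 1, 2, 4, 8`), from the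
  kernel-checked certificate tables `stub_weight_two` (12 certificates, file `…StubWeightTwo`) and
  `stub_weight_three` (72 certificates, file `…StubWeightThree`; weight 3 contains Zhao's non-standard
  relation) and `spanBound_of_twoLetterNormalForm` (`#twoWords w ≤ 2^w`). These are the first weights of
  the informal item ("computed for w ≤ 5, 6") that are THEOREMS rather than ranks modulo a prime. Sources: J. Zhao, Doc. Math. 15 (2010) §2, §5
[Zhao2010]; P. Deligne, Publ. IHÉS 112 (2010) (`d(w,4) = 2^w`) [Deligne2010].
-/

noncomputable section

namespace Summit.KontsevichZagierPeriods.OctahedralSymmetry.OctaSpan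

open Literature.NumberTheory.Transcendental Literature.NumberTheory.Transcendental.LevelFour

/-- **Weight 0**: the empty word is the (only) two-letter word of length `0`. [folklore] -/
theorem twoLetterNormalForm_zero : TwoLetterNormalForm 0 := by
  intro W hlen _
  have hW : W = [] := List.eq_nil_of_length_eq_zero hlen
  subst hW
  exact Submodule.mem_sup_right (Submodule.subset_span ⟨[], by decide, rfl⟩)

/-- **Weight 1**: the convergent letters are `1, 2, 3` (poles `i, −1, −i`); `[1]`, `[3]` are two-letter
words and `[2] = dilGen [2] + [1] + [3]` (the seed `log 2 = log(1+i) + log(1−i)`, i.e. the squaring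
substitution on `dt/(t+1)`). [cite: Zhao2010, §5] -/
theorem twoLetterNormalForm_one : TwoLetterNormalForm 1 := by
  intro W hlen hW
  obtain ⟨a, rfl⟩ : ∃ a, W = [a] := by
    match W, hlen with
    | [a], _ => exact ⟨a, rfl⟩
  have h1 : sym [(1 : Fin 5)] ∈ twoSpan 1 := Submodule.subset_span ⟨[1], by decide, rfl⟩
  have h3 : sym [(3 : Fin 5)] ∈ twoSpan 1 := Submodule.subset_span ⟨[3], by decide, rfl⟩
  have key : a = 0 ∨ a = 1 ∨ a = 2 ∨ a = 3 ∨ a = 4 := by fin_cases a <;> simp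
  rcases key with rfl | rfl | rfl | rfl | rfl
  · exact absurd rfl hW.1
  · exact Submodule.mem_sup_right h1
  · -- the seed
    have hgen : dilGen [2] ∈ rel := mem_rel_of_isGen (IsGen.dil (by decide) (by decide))
    have hdil : toQ (dilSubst [2]) = sym [1] + sym [3] := by
      simp [dilSubst, dilLetter, toQ_single]
    have hsym : sym [(2 : Fin 5)] = dilGen [2] + (sym [1] + sym [3]) := by
      rw [dilGen, hdil]; abel
    rw [hsym]
    exact Submodule.add_mem _ (Submodule.mem_sup_left hgen)
      (Submodule.mem_sup_right (Submodule.add_mem _ h1 h3))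
  · exact Submodule.mem_sup_right h3
  · exact absurd rfl hW.2

/-- **The crux in weights `≤ 3`** (corank `≤ 1, 2, 4, 8`): `SpanBound w` for `w ≤ 3`, with the `2^w` words
over the poles `±i` as the spanning set; weights `2` and `3` are the kernel-checked certificate tables
`stub_weight_two`, `stub_weight_three`. [cite: Deligne2010, §1] -/
theorem spanBound_of_le_three (w : ℕ) (hw : w ≤ 3) : SpanBound w := by
  interval_cases w
  · exact spanBound_of_twoLetterNormalForm twoLetterNormalForm_zero
  · exact spanBound_of_twoLetterNormalForm twoLetterNormalForm_one
  · exact spanBound_of_twoLetterNormalForm stub_weight_two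
  · exact spanBound_of_twoLetterNormalForm stub_weight_three

/-! ## Weight 4 (appended when `stub_weight_four` landed) and the real form -/

/-- `TwoLetterNormalForm w` for every `w ≤ 4`: the `2^w` words over the poles `±i` span the convergent
words of weight `w` modulo `rel` (weights 2, 3, 4 by kernel-checked certificate tables; weight 4 uses
REFERENCED certificates, file `…StubWeightFour*`). [cite: Zhao2010, §2] -/
theorem twoLetterNormalForm_of_le_four (w : ℕ) (hw : w ≤ 4) : TwoLetterNormalForm w := by
  interval_cases w
  · exact twoLetterNormalForm_zero
  · exact twoLetterNormalForm_one
  · exact stub_weight_two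
  · exact stub_weight_three
  · exact stub_weight_four

/-- **The crux in weights `≤ 4`** (corank `≤ 1, 2, 4, 8, 16`). [cite: Deligne2010, §1] -/
theorem spanBound_of_le_four (w : ℕ) (hw : w ≤ 4) : SpanBound w :=
  spanBound_of_twoLetterNormalForm (twoLetterNormalForm_of_le_four w hw)

/-- **The REAL form of the crux in weights `≤ 4`**: at most `2^w` of the real symbols `Re I(W)`,
`Im I(W)` span all of them modulo the six real families (file `…RealForm`). [cite: Deligne2010, §1] -/
theorem realSpanBound_of_le_four (w : ℕ) (hw : w ≤ 4) : RealSpanBound w :=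
  realSpanBound_of_twoLetterNormalForm (twoLetterNormalForm_of_le_four w hw)

end Summit.KontsevichZagierPeriods.OctahedralSymmetry.OctaSpan

end
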